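import Literature.AnabelianGeometry.EtaleTheta.Discharge.Sec5Prop52AtGenuineBases
import Literature.AnabelianGeometry.EtaleTheta.Discharge.Sec5OfThetaSettingQ

/-!
# [EtTh] Prop. 5.2 (ii)/(iii) p.324, §5 pp.322, 330–331 (PDF pp.98, 96, 104–105): the rows `StrvSection` (F-0555), `ThetaPairActionsAgree` (F-0556), `ThetaPairKummerClass` (F-0558) at the §5 data OF THE §1 SETTING

Mochizuki, *The étale theta function and its Frobenioid-theoretic manifestations*, Publ. RIMS **45** (2009)
[cite: MochizukiEtTh2009, Prop 5.2 p.324 (PDF p.98); §5 p.322 (PDF p.96); §5 p.330–331 (PDF pp.104–105); Prop 4.3 (iii) p.317 (PDF p.91)].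
abc-iut cell, block F (FACT-PROVING wave, batch 2), seat abc-iut-f-126 (gen 5; tranche 126 = FACT-LIST rows **F-0555**
`ThetaFrobenioid.StrvSection`, **F-0556** `FrobenioidThetaBiKummer.ThetaPairActionsAgree`, **F-0558**
`FrobenioidThetaBiKummer.ThetaPairKummerClass`, trunk `FrobenioidThetaBiKummer.lean`).  PROOF-ONLY sequel of this seat's
`Discharge/Sec5Prop52AtGenuineBases.lean` (p436586; the rows at `ofConnectedTemperoid(Ydd)Data` / `ofTemperoidData`) and
`Discharge/Sec5Prop52AtTowerLevels.lean` (p436587; the rows at every level of `ofConnectedTemperoidFamily` / the `Ÿ`-tower): no `def`, no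
`Prop` fact, no instance; nothing landed is edited or restated — every conjunct that already has a name is CITED.

The three rows are `parametrised` predicates on the DATA-ONLY interface `𝔉 : ThetaFrobenioid C D` (universal closures REFUTED, abc-iut-w6-d043
`Sec5BiKummerSchemaVerdicts`; FACT-LIST rule R5: consumed at NAMED instances).  WHAT IS NEW HERE — the rows at the NAMED §5 instances that pin
the three `Π`-side inputs `(X, T, ιX)` to the §1 Setting (abc-iut-L2-t4, ROW W3-L2-01 "§5 GENUINE DATA", `Discharge/Sec5OfThetaSetting.lean` /
`Discharge/Sec5OfThetaSettingQ.lean`: `X := Π^tp_X̲̲ = C.Huu` as an [SemiAnbd] Ex. 3.10 datum, `T :=` abc-iut-L2-t8's `C.thetaEnvData μ hC hS`,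
`ιX := id`; base category `B^temp(Π^tp_X̲̲)⁰`), i.e. at the binder-census object of record of the L2 §5 lane:

* `ThetaFrobenioid.ofThetaSettingData` (any Frobenius-trivial Galois `A_⊙`): `isAutAmple_AN_ofThetaSettingData` (F-0555 consequence,
  UNCONDITIONAL), `thetaPairActionsAgree_ofThetaSettingData_iff` (Prop. 5.2 (ii) as a characterisation, UNCONDITIONAL),
  `prop52Rows_ofThetaSettingData_of_hH` = `StrvSection ∧ (A_N Aut-ample) ∧ (∀ ν, ∃ η, ThetaPairKummerClass η ν)` MODULO THE SINGLE PRINTED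
  INPUT `hH` (`Π^tp_Ÿ̲̲ ⊆ H_⊙`, §5 p.322); the same with the divisor inputs supplied from the `Π^tp_X̲̲`-stability `hθ`, `hθ'` of `Div(Θ̈)_±`
  (`ofThetaSettingDataOfThetaDivisor`, GAP G-L2t4-2 binders carried BY NAME); and with `(l·Δ_Θ)_(−)` PINNED to abc-iut-L2-t9's
  `ThetaSubquotient.ofSettingSub` (`ofThetaSettingDataQ`).
* `A_⊙^bs := Ÿ̲̲` (`BiKummerSetting.mkOfThetaSettingYdd`, `H_⊙ = Π^tp_Ÿ̲̲` on the nose): `prop52Rows_ofThetaSettingYddData(Q)` —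
  F-0555, "`A_N` is Aut-ample" and F-0558 (`η`-existential, every `ν`) with NO named `Π`-side input (`hH :=` abc-iut-L2-t4's THEOREM
  `hH_mkOfThetaSettingYdd`).
* The TOWER of the Setting (`ThetaFrobenioidTower.ofThetaSettingFamily`, Rmk. 4.3.2) is the companion file
  `Discharge/Sec5Prop52AtThetaSettingTower.lean` (same seat); its levels `M ∈ E` ARE the one-level data `ofThetaSettingData (τ.mod M)`
  (abc-iut-L2-t4's `atLevel_ofThetaSettingFamily_eq`, `rfl`), covered by the first bullet here.

Every proof is a citation: `ofThetaSettingData` IS `ofConnectedTemperoidData` at `(Π^tp_X̲̲, C.thetaEnvData μ hC hS, id)` (abc-iut-L2-t4's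
`ofThetaSettingData_eq`, `rfl`), so this seat's `prop52Rows_ofConnectedTemperoidData_of_hH` (F-0555 = abc-iut-L2-t4's
`strvSection_ofConnectedTemperoidData`; F-0558 ⟸ Prop. 4.3 (iii) `biKummerDifferenceMem_ofConnectedTemperoidData`, abc-iut-w6-d054; witness
`η := ν⁻¹ ∘ (s^⊓-gp_N · (s^⊔-gp_N)⁻¹)`, `u := 1` — the PINNED `η` of print, MERGE-PLAN row 6, is NOT claimed) and abc-iut-w6-d086's
`thetaPairActionsAgree_ofConnectedTemperoidData_iff` (total epimorphicity = [FrdI] Thm. 5.2, `epi_of_model`) apply verbatim.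
RESIDUAL INPUTS (each printed; none a Prop-valued definition; none a FACT-LIST name): the tempered Frobenioid `tf` of Ex. 3.9 over
`B^temp(Π^tp_X̲̲)⁰` (Def. 3.6 (ii) DATA), `h` ([FrdI] Thm. 5.2 hypotheses of the model), `Q` (or the pin), the roots `Rl` / `R`, the constants
`K', constEmb`, the divisor invariances `hinvc` (p.330) / `hinvp` (Prop. 4.3 (i) proof, p.317) or `hθ`/`hθ'`; Setting side `e`, `hC : Compat`,
`hS : Sec2Hyps`, `μ : CyclotomeMod`.
HONEST FRAMING: kernel-checked consequences for data so constructed; the parameter `tf` is NOT shown inhabited for the curve; nothing of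
[EtTh] (a refereed paper) is asserted unconditionally; a FACT row is an assumption label, not an endorsement; nothing here bears on
[IUTchIII] Cor. 3.12; no side is taken; typed ≠ proved.
-/

noncomputable section

namespace Literature.AnabelianGeometry.EtaleTheta

open CategoryTheory Opposite Literature.AlgebraicGeometry.Frobenioids Literature.AnabelianGeometry.SemiGraphs
  Literature.AnabelianGeometry.SemiGraphs.GaloisObjects Literature.AlgebraicGeometry.Frobenioids.QuasiTemperoid.BTempConnected

universe v₀

/-! ### At the §5 data of the Setting (`ofThetaSettingData`, any Frobenius-trivial Galois `A_⊙`): modulo `hH` alone -/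

namespace ThetaFrobenioid

section OfThetaSettingData

variable {p : ℕ} [Fact p.Prime] {D : ThetaSetting p} {E : D.EtaleThetaData} {l : ℕ} {C : E.DoubleUnderline l}
  {e : D.toTemperedCurve.GroupLevelData} {N : ℕ+} (μ : D.CyclotomeMod l N) (hC : D.Compat) (hS : D.Sec2Hyps)
  {D₀ : Type} [Category.{v₀} D₀] {V : FrdIMonoidStub.{0}} {T₀ : RealifiedDivisorMonoids (D₀ := D₀) V}
  {VD : FrdICatStub.{1, 0, 0} (ConnectedPart (BTemp (C.temperedArithmeticGroup e).Pi))}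
  {tf : TemperedFrobenioid T₀ (ConnectedPart (BTemp (C.temperedArithmeticGroup e).Pi)) VD} {hZ : tf.monoidType = MonoidType.Z}
  {hP : ∀ A : (ConnectedPart (BTemp (C.temperedArithmeticGroup e).Pi))ᵒᵖ, IsPerfect (tf.Φ.carrier A)}
  {NH : Subgroup (Field.absoluteGaloisGroup D.K) → tf.category → ℕ+ → Prop} {A₀ : tf.category}
  {hA₀ : PreFrobenioid.IsFrobeniusTrivial tf.toElem A₀} {hA₀' : SemiGraphs.IsGaloisObj A₀.base.obj}
  {pullFrac : ∀ {A A' : (BiKummerSetting.mkOfConnectedTemperoid (C.temperedArithmeticGroup e) tf hZ hP NH A₀ hA₀ hA₀').C} (_ : A' ⟶ A),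
    (BiKummerSetting.mkOfConnectedTemperoid (C.temperedArithmeticGroup e) tf hZ hP NH A₀ hA₀ hA₀').biratUnits A →
      (BiKummerSetting.mkOfConnectedTemperoid (C.temperedArithmeticGroup e) tf hZ hP NH A₀ hA₀ hA₀').biratUnits A'}
  {θ : (BiKummerSetting.mkOfConnectedTemperoid (C.temperedArithmeticGroup e) tf hZ hP NH A₀ hA₀ hA₀').biratUnits
    (BiKummerSetting.mkOfConnectedTemperoid (C.temperedArithmeticGroup e) tf hZ hP NH A₀ hA₀ hA₀').Aodot}
  {Bl : (BiKummerSetting.mkOfConnectedTemperoid (C.temperedArithmeticGroup e) tf hZ hP NH A₀ hA₀ hA₀').C}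
  {Pl : (BiKummerSetting.mkOfConnectedTemperoid (C.temperedArithmeticGroup e) tf hZ hP NH A₀ hA₀ hA₀').FractionPair θ Bl}
  {Rl : (BiKummerSetting.mkOfConnectedTemperoid (C.temperedArithmeticGroup e) tf hZ hP NH A₀ hA₀ hA₀').NthRoot θ Pl C.lPNat pullFrac}
  (h : ModelFrobenioid.Hypotheses tf.divisorMonoid tf.ratFnFunctor)
  (Q : FrobenioidTheta.ThetaSubquotientStub.{0} (ConnectedPart (BTemp (C.temperedArithmeticGroup e).Pi)))
  (R : (BiKummerSetting.mkOfConnectedTemperoid (C.temperedArithmeticGroup e) tf hZ hP NH A₀ hA₀ hA₀').NthRoot Rl.root Rl.pair N pullFrac)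
  (K' : Type) [Field K'] (constEmb : K'ˣ →* tf.biratUnitsModel R.BN) (constEmb_injective : Function.Injective constEmb)

section General

variable
  (hinvc : ∀ g : Aut R.AN.base,
    pull tf.divisorMonoid g.hom (ModelFrobenioid.div R.pair.num) = ModelFrobenioid.div R.pair.num)
  (hinvp : ∀ y : (C.thetaEnvData μ hC hS).PiX, y ∈ (C.thetaEnvData μ hC hS).PiYdd →
    pull tf.divisorMonoid ((BiKummerSetting.mkOfConnectedTemperoid (C.temperedArithmeticGroup e) tf hZ hP NH A₀ hA₀ hA₀').galoisSurj
      R.AN.base R.αData.isGalois ((ContinuousMulEquiv.refl _) y)).hom (ModelFrobenioid.div R.pair.den) = ModelFrobenioid.div R.pair.den)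

/-- **F-0555 consequence at the §5 data of the Setting, UNCONDITIONAL**: "`A_N` is Aut-ample" ([FrdI] Def. 1.2 (iv)) — `s^trv_N` is
CONSTRUCTED over `B^temp(Π^tp_X̲̲)⁰` (abc-iut-L2-t4's `strvSection_ofConnectedTemperoidData`, read at `(Π^tp_X̲̲, C.thetaEnvData μ hC hS, id)`).
[cite: MochizukiEtTh2009, §5 p.330–331 (PDF pp.104–105)] -/
theorem isAutAmple_AN_ofThetaSettingData :
    (ofThetaSettingData μ hC hS h Q R K' constEmb constEmb_injective hinvc hinvp).IsAutAmple
      (ofThetaSettingData μ hC hS h Q R K' constEmb constEmb_injective hinvc hinvp).AN :=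
  isAutAmple_AN_ofConnectedTemperoidData (T := C.thetaEnvData μ hC hS) h Q C.odd_lPNat R (ContinuousMulEquiv.refl _) K'
    constEmb constEmb_injective hinvc hinvp

/-- **[EtTh] Prop. 5.2 (ii) (F-0556) at the §5 data of the Setting, as a characterisation, UNCONDITIONAL**: a pair `(actS, actT)` of
`H_{B_N}`-actions on `B_N` agrees with "the actions determined by the bi-Kummer `l·N`-th root [cf. Proposition 4.3, (i)]" IFF it is
compatible with `s^⊓_N`, `s^⊔_N` (total epimorphicity = [FrdI] Thm. 5.2 for the model Frobenioid over `B^temp(Π^tp_X̲̲)⁰`, `epi_of_model`;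
defining relations = abc-iut-L2-t4's `sgpCapSpec_…` / `sgpCupSpec_ofConnectedTemperoidData`; abc-iut-w6-d086's
`thetaPairActionsAgree_ofConnectedTemperoidData_iff` read at `(Π^tp_X̲̲, C.thetaEnvData μ hC hS, id)`).
[cite: MochizukiEtTh2009, Prop 5.2 (ii) p.324 (PDF p.98); §5 p.331 (PDF p.105)] -/
theorem thetaPairActionsAgree_ofThetaSettingData_iff
    (actS actT : (ofThetaSettingData μ hC hS h Q R K' constEmb constEmb_injective hinvc hinvp).HB →*
      Aut (ofThetaSettingData μ hC hS h Q R K' constEmb constEmb_injective hinvc hinvp).BN) :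
    FrobenioidThetaBiKummer.ThetaPairActionsAgree (ofThetaSettingData μ hC hS h Q R K' constEmb constEmb_injective hinvc hinvp)
        actS actT ↔
      (∀ hh : (ofThetaSettingData μ hC hS h Q R K' constEmb constEmb_injective hinvc hinvp).HB,
          (ofThetaSettingData μ hC hS h Q R K' constEmb constEmb_injective hinvc hinvp).sCap ≫ (actS hh).hom =
            ((ofThetaSettingData μ hC hS h Q R K' constEmb constEmb_injective hinvc hinvp).strv
              ((ofThetaSettingData μ hC hS h Q R K' constEmb constEmb_injective hinvc hinvp).autBaseIsoAB.symm
                (hh : Aut ((ofThetaSettingData μ hC hS h Q R K' constEmb constEmb_injective hinvc hinvp).base.obj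
                  (ofThetaSettingData μ hC hS h Q R K' constEmb constEmb_injective hinvc hinvp).BN)))).hom ≫
              (ofThetaSettingData μ hC hS h Q R K' constEmb constEmb_injective hinvc hinvp).sCap) ∧
        ∀ hh : (ofThetaSettingData μ hC hS h Q R K' constEmb constEmb_injective hinvc hinvp).HB,
          (ofThetaSettingData μ hC hS h Q R K' constEmb constEmb_injective hinvc hinvp).sCup ≫ (actT hh).hom =
            ((ofThetaSettingData μ hC hS h Q R K' constEmb constEmb_injective hinvc hinvp).strv
              ((ofThetaSettingData μ hC hS h Q R K' constEmb constEmb_injective hinvc hinvp).autBaseIsoAB.symm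
                (hh : Aut ((ofThetaSettingData μ hC hS h Q R K' constEmb constEmb_injective hinvc hinvp).base.obj
                  (ofThetaSettingData μ hC hS h Q R K' constEmb constEmb_injective hinvc hinvp).BN)))).hom ≫
              (ofThetaSettingData μ hC hS h Q R K' constEmb constEmb_injective hinvc hinvp).sCup :=
  thetaPairActionsAgree_ofConnectedTemperoidData_iff (T := C.thetaEnvData μ hC hS) h Q C.odd_lPNat R (ContinuousMulEquiv.refl _)
    K' constEmb constEmb_injective hinvc hinvp actS actT

/-- **F-0558 at the §5 data of the Setting, `η`-existential form, MODULO `hH` ALONE** (`Π^tp_Ÿ̲̲ ⊆ H_⊙`, §5 p.322): for EVERY comparison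
`ν : (l·Δ_Θ)_{B_N} ⊗ ℤ/N ≃ μ_N(B_N)`, SOME cocycle on `H_{B_N}` satisfies Prop. 5.2 (iii) in cocycle form — from Prop. 4.3 (iii)
(abc-iut-w6-d054's `biKummerDifferenceMem_ofConnectedTemperoidData`, via this seat's `exists_thetaPairKummerClass_ofConnectedTemperoidData_of_hH`).
[cite: MochizukiEtTh2009, Prop 5.2 (iii) p.324 (PDF p.98); Prop 4.3 (iii) p.317 (PDF p.91); §5 p.322 (PDF p.96)] -/
theorem exists_thetaPairKummerClass_ofThetaSettingData_of_hH
    (hH : ∀ y : (C.thetaEnvData μ hC hS).PiX, y ∈ (C.thetaEnvData μ hC hS).PiYdd →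
      (ContinuousMulEquiv.refl _) y ∈ (BiKummerSetting.mkOfConnectedTemperoid (C.temperedArithmeticGroup e) tf hZ hP NH A₀ hA₀ hA₀').Hodot)
    (ν : (ofThetaSettingData μ hC hS h Q R K' constEmb constEmb_injective hinvc hinvp).lDeltaModN
        (ofThetaSettingData μ hC hS h Q R K' constEmb constEmb_injective hinvc hinvp).BN ≃*
      (ofThetaSettingData μ hC hS h Q R K' constEmb constEmb_injective hinvc hinvp).muTorsion
        (ofThetaSettingData μ hC hS h Q R K' constEmb constEmb_injective hinvc hinvp).BN
        (ofThetaSettingData μ hC hS h Q R K' constEmb constEmb_injective hinvc hinvp).N) :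
    ∃ η : (ofThetaSettingData μ hC hS h Q R K' constEmb constEmb_injective hinvc hinvp).HB →
        (ofThetaSettingData μ hC hS h Q R K' constEmb constEmb_injective hinvc hinvp).lDeltaModN
          (ofThetaSettingData μ hC hS h Q R K' constEmb constEmb_injective hinvc hinvp).BN,
      FrobenioidThetaBiKummer.ThetaPairKummerClass
        (ofThetaSettingData μ hC hS h Q R K' constEmb constEmb_injective hinvc hinvp) η ν :=
  exists_thetaPairKummerClass_ofConnectedTemperoidData_of_hH (T := C.thetaEnvData μ hC hS) h Q C.odd_lPNat R
    (ContinuousMulEquiv.refl _) K' constEmb constEmb_injective hinvc hinvp hH ν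

/-- **Tranche-126 certificate at the §5 data of the Setting MODULO THE SINGLE PRINTED INPUT `hH`** (`Π^tp_Ÿ̲̲ ⊆ H_⊙`): F-0555 `StrvSection`
(UNCONDITIONAL), "`A_N` is Aut-ample", and F-0558 in `η`-existential form for every `ν`; F-0556 there (⟺ the defining relations,
UNCONDITIONAL) is `thetaPairActionsAgree_ofThetaSettingData_iff`.
[cite: MochizukiEtTh2009, Prop 5.2 p.324 (PDF p.98); §5 p.322 (PDF p.96); §5 p.331 (PDF p.105)] -/
theorem prop52Rows_ofThetaSettingData_of_hH
    (hH : ∀ y : (C.thetaEnvData μ hC hS).PiX, y ∈ (C.thetaEnvData μ hC hS).PiYdd →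
      (ContinuousMulEquiv.refl _) y ∈ (BiKummerSetting.mkOfConnectedTemperoid (C.temperedArithmeticGroup e) tf hZ hP NH A₀ hA₀ hA₀').Hodot) :
    (ofThetaSettingData μ hC hS h Q R K' constEmb constEmb_injective hinvc hinvp).StrvSection ∧
    (ofThetaSettingData μ hC hS h Q R K' constEmb constEmb_injective hinvc hinvp).IsAutAmple
        (ofThetaSettingData μ hC hS h Q R K' constEmb constEmb_injective hinvc hinvp).AN ∧
    ∀ ν : (ofThetaSettingData μ hC hS h Q R K' constEmb constEmb_injective hinvc hinvp).lDeltaModN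
          (ofThetaSettingData μ hC hS h Q R K' constEmb constEmb_injective hinvc hinvp).BN ≃*
        (ofThetaSettingData μ hC hS h Q R K' constEmb constEmb_injective hinvc hinvp).muTorsion
          (ofThetaSettingData μ hC hS h Q R K' constEmb constEmb_injective hinvc hinvp).BN
          (ofThetaSettingData μ hC hS h Q R K' constEmb constEmb_injective hinvc hinvp).N,
      ∃ η : (ofThetaSettingData μ hC hS h Q R K' constEmb constEmb_injective hinvc hinvp).HB →
          (ofThetaSettingData μ hC hS h Q R K' constEmb constEmb_injective hinvc hinvp).lDeltaModN
            (ofThetaSettingData μ hC hS h Q R K' constEmb constEmb_injective hinvc hinvp).BN,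
        FrobenioidThetaBiKummer.ThetaPairKummerClass
          (ofThetaSettingData μ hC hS h Q R K' constEmb constEmb_injective hinvc hinvp) η ν :=
  prop52Rows_ofConnectedTemperoidData_of_hH (T := C.thetaEnvData μ hC hS) h Q C.odd_lPNat R (ContinuousMulEquiv.refl _) K'
    constEmb constEmb_injective hinvc hinvp hH

end General

/-! ### With the divisor inputs supplied from the `Π^tp_X̲̲`-stability of `Div(Θ̈)_±` (`ofThetaSettingDataOfThetaDivisor`) -/

section ThetaDivisor

variable
  (hθ : ∀ x : C.Huu, pull tf.divisorMonoid ((BiKummerSetting.mkOfConnectedTemperoid (C.temperedArithmeticGroup e) tf hZ hP NH A₀ hA₀ hA₀').galoisSurj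
    A₀.base hA₀' x).hom (ModelFrobenioid.div Pl.num) = ModelFrobenioid.div Pl.num)
  (hθ' : ∀ x : C.Huu, pull tf.divisorMonoid ((BiKummerSetting.mkOfConnectedTemperoid (C.temperedArithmeticGroup e) tf hZ hP NH A₀ hA₀ hA₀').galoisSurj
    A₀.base hA₀' x).hom (ModelFrobenioid.div Pl.den) = ModelFrobenioid.div Pl.den)

/-- **Tranche-126 certificate at the §5 data of the Setting with the divisor inputs from `hθ`, `hθ'`** (the `Π^tp_X̲̲`-stability of the zero /
polar divisor of the fraction-pair of `Θ̈` on `A_⊙`, Prop. 4.3 (i) proof p.317; GAP G-L2t4-2 binders, carried BY NAME), MODULO `hH`: F-0555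
`StrvSection`, "`A_N` is Aut-ample", F-0558 (`η`-existential, every `ν`).
[cite: MochizukiEtTh2009, Prop 5.2 p.324 (PDF p.98); Prop 4.3 (i) p.317 (PDF p.91); §5 p.330 (PDF p.104)] -/
theorem prop52Rows_ofThetaSettingDataOfThetaDivisor_of_hH
    (hH : ∀ y : (C.thetaEnvData μ hC hS).PiX, y ∈ (C.thetaEnvData μ hC hS).PiYdd →
      (ContinuousMulEquiv.refl _) y ∈ (BiKummerSetting.mkOfConnectedTemperoid (C.temperedArithmeticGroup e) tf hZ hP NH A₀ hA₀ hA₀').Hodot) :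
    (ofThetaSettingDataOfThetaDivisor μ hC hS h Q R K' constEmb constEmb_injective hθ hθ').StrvSection ∧
    (ofThetaSettingDataOfThetaDivisor μ hC hS h Q R K' constEmb constEmb_injective hθ hθ').IsAutAmple
        (ofThetaSettingDataOfThetaDivisor μ hC hS h Q R K' constEmb constEmb_injective hθ hθ').AN ∧
    ∀ ν : (ofThetaSettingDataOfThetaDivisor μ hC hS h Q R K' constEmb constEmb_injective hθ hθ').lDeltaModN
          (ofThetaSettingDataOfThetaDivisor μ hC hS h Q R K' constEmb constEmb_injective hθ hθ').BN ≃*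
        (ofThetaSettingDataOfThetaDivisor μ hC hS h Q R K' constEmb constEmb_injective hθ hθ').muTorsion
          (ofThetaSettingDataOfThetaDivisor μ hC hS h Q R K' constEmb constEmb_injective hθ hθ').BN
          (ofThetaSettingDataOfThetaDivisor μ hC hS h Q R K' constEmb constEmb_injective hθ hθ').N,
      ∃ η : (ofThetaSettingDataOfThetaDivisor μ hC hS h Q R K' constEmb constEmb_injective hθ hθ').HB →
          (ofThetaSettingDataOfThetaDivisor μ hC hS h Q R K' constEmb constEmb_injective hθ hθ').lDeltaModN
            (ofThetaSettingDataOfThetaDivisor μ hC hS h Q R K' constEmb constEmb_injective hθ hθ').BN,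
        FrobenioidThetaBiKummer.ThetaPairKummerClass
          (ofThetaSettingDataOfThetaDivisor μ hC hS h Q R K' constEmb constEmb_injective hθ hθ') η ν :=
  prop52Rows_ofThetaSettingData_of_hH μ hC hS h Q R K' constEmb constEmb_injective (hinvc_ofConnectedTemperoid h R hθ)
    (hinvp_ofConnectedTemperoid (T := C.thetaEnvData μ hC hS) h R (ContinuousMulEquiv.refl _) hθ') hH

end ThetaDivisor

/-! ### With `(l·Δ_Θ)_(−)` pinned to abc-iut-L2-t9's `ThetaSubquotient.ofSettingSub` (`ofThetaSettingDataQ`) -/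

section Pinned

variable
  (hinvc : ∀ g : Aut R.AN.base,
    pull tf.divisorMonoid g.hom (ModelFrobenioid.div R.pair.num) = ModelFrobenioid.div R.pair.num)
  (hinvp : ∀ y : (C.thetaEnvData μ hC hS).PiX, y ∈ (C.thetaEnvData μ hC hS).PiYdd →
    pull tf.divisorMonoid ((BiKummerSetting.mkOfConnectedTemperoid (C.temperedArithmeticGroup e) tf hZ hP NH A₀ hA₀ hA₀').galoisSurj
      R.AN.base R.αData.isGalois ((ContinuousMulEquiv.refl _) y)).hom (ModelFrobenioid.div R.pair.den) = ModelFrobenioid.div R.pair.den)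

/-- **[EtTh] Prop. 5.2 (ii) (F-0556) at the §5 data of the Setting with `(l·Δ_Θ)_(−)` PINNED, as a characterisation, UNCONDITIONAL.**
[cite: MochizukiEtTh2009, Prop 5.2 (ii) p.324 (PDF p.98); §5 p.327 (PDF p.101); §5 p.331 (PDF p.105)] -/
theorem thetaPairActionsAgree_ofThetaSettingDataQ_iff
    (actS actT : (ofThetaSettingDataQ μ hC hS h R K' constEmb constEmb_injective hinvc hinvp).HB →*
      Aut (ofThetaSettingDataQ μ hC hS h R K' constEmb constEmb_injective hinvc hinvp).BN) :
    FrobenioidThetaBiKummer.ThetaPairActionsAgree (ofThetaSettingDataQ μ hC hS h R K' constEmb constEmb_injective hinvc hinvp)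
        actS actT ↔
      (∀ hh : (ofThetaSettingDataQ μ hC hS h R K' constEmb constEmb_injective hinvc hinvp).HB,
          (ofThetaSettingDataQ μ hC hS h R K' constEmb constEmb_injective hinvc hinvp).sCap ≫ (actS hh).hom =
            ((ofThetaSettingDataQ μ hC hS h R K' constEmb constEmb_injective hinvc hinvp).strv
              ((ofThetaSettingDataQ μ hC hS h R K' constEmb constEmb_injective hinvc hinvp).autBaseIsoAB.symm
                (hh : Aut ((ofThetaSettingDataQ μ hC hS h R K' constEmb constEmb_injective hinvc hinvp).base.obj
                  (ofThetaSettingDataQ μ hC hS h R K' constEmb constEmb_injective hinvc hinvp).BN)))).hom ≫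
              (ofThetaSettingDataQ μ hC hS h R K' constEmb constEmb_injective hinvc hinvp).sCap) ∧
        ∀ hh : (ofThetaSettingDataQ μ hC hS h R K' constEmb constEmb_injective hinvc hinvp).HB,
          (ofThetaSettingDataQ μ hC hS h R K' constEmb constEmb_injective hinvc hinvp).sCup ≫ (actT hh).hom =
            ((ofThetaSettingDataQ μ hC hS h R K' constEmb constEmb_injective hinvc hinvp).strv
              ((ofThetaSettingDataQ μ hC hS h R K' constEmb constEmb_injective hinvc hinvp).autBaseIsoAB.symm
                (hh : Aut ((ofThetaSettingDataQ μ hC hS h R K' constEmb constEmb_injective hinvc hinvp).base.obj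
                  (ofThetaSettingDataQ μ hC hS h R K' constEmb constEmb_injective hinvc hinvp).BN)))).hom ≫
              (ofThetaSettingDataQ μ hC hS h R K' constEmb constEmb_injective hinvc hinvp).sCup :=
  thetaPairActionsAgree_ofThetaSettingData_iff μ hC hS h (ThetaSubquotient.ofSettingSub D l C.Huu) R K' constEmb constEmb_injective
    hinvc hinvp actS actT

/-- **Tranche-126 certificate at the §5 data of the Setting with `(l·Δ_Θ)_(−)` PINNED, MODULO `hH`**: F-0555 `StrvSection`, "`A_N` is
Aut-ample", F-0558 (`η`-existential, every comparison `ν` on the pinned `(l·Δ_Θ)_{B_N} ⊗ ℤ/N`).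
[cite: MochizukiEtTh2009, Prop 5.2 p.324 (PDF p.98); §5 p.327 (PDF p.101); §5 p.331 (PDF p.105)] -/
theorem prop52Rows_ofThetaSettingDataQ_of_hH
    (hH : ∀ y : (C.thetaEnvData μ hC hS).PiX, y ∈ (C.thetaEnvData μ hC hS).PiYdd →
      (ContinuousMulEquiv.refl _) y ∈ (BiKummerSetting.mkOfConnectedTemperoid (C.temperedArithmeticGroup e) tf hZ hP NH A₀ hA₀ hA₀').Hodot) :
    (ofThetaSettingDataQ μ hC hS h R K' constEmb constEmb_injective hinvc hinvp).StrvSection ∧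
    (ofThetaSettingDataQ μ hC hS h R K' constEmb constEmb_injective hinvc hinvp).IsAutAmple
        (ofThetaSettingDataQ μ hC hS h R K' constEmb constEmb_injective hinvc hinvp).AN ∧
    ∀ ν : (ofThetaSettingDataQ μ hC hS h R K' constEmb constEmb_injective hinvc hinvp).lDeltaModN
          (ofThetaSettingDataQ μ hC hS h R K' constEmb constEmb_injective hinvc hinvp).BN ≃*
        (ofThetaSettingDataQ μ hC hS h R K' constEmb constEmb_injective hinvc hinvp).muTorsion
          (ofThetaSettingDataQ μ hC hS h R K' constEmb constEmb_injective hinvc hinvp).BN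
          (ofThetaSettingDataQ μ hC hS h R K' constEmb constEmb_injective hinvc hinvp).N,
      ∃ η : (ofThetaSettingDataQ μ hC hS h R K' constEmb constEmb_injective hinvc hinvp).HB →
          (ofThetaSettingDataQ μ hC hS h R K' constEmb constEmb_injective hinvc hinvp).lDeltaModN
            (ofThetaSettingDataQ μ hC hS h R K' constEmb constEmb_injective hinvc hinvp).BN,
        FrobenioidThetaBiKummer.ThetaPairKummerClass
          (ofThetaSettingDataQ μ hC hS h R K' constEmb constEmb_injective hinvc hinvp) η ν :=
  prop52Rows_ofThetaSettingData_of_hH μ hC hS h (ThetaSubquotient.ofSettingSub D l C.Huu) R K' constEmb constEmb_injective hinvc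
    hinvp hH

end Pinned

end OfThetaSettingData

/-! ### `A_⊙^bs := Ÿ̲̲` (`BiKummerSetting.mkOfThetaSettingYdd`, `H_⊙ = Π^tp_Ÿ̲̲`): NO named `Π`-side input -/

section OfThetaSettingYddData

variable {p : ℕ} [Fact p.Prime] {D : ThetaSetting p} {E : D.EtaleThetaData} {l : ℕ} {C : E.DoubleUnderline l}
  {e : D.toTemperedCurve.GroupLevelData} {N : ℕ+} (μ : D.CyclotomeMod l N) (hC : D.Compat) (hS : D.Sec2Hyps)
  {D₀ : Type} [Category.{v₀} D₀] {V : FrdIMonoidStub.{0}} {T₀ : RealifiedDivisorMonoids (D₀ := D₀) V}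
  {VD : FrdICatStub.{1, 0, 0} (ConnectedPart (BTemp (C.temperedArithmeticGroup e).Pi))}
  {tf : TemperedFrobenioid T₀ (ConnectedPart (BTemp (C.temperedArithmeticGroup e).Pi)) VD} {hZ : tf.monoidType = MonoidType.Z}
  {hP : ∀ A : (ConnectedPart (BTemp (C.temperedArithmeticGroup e).Pi))ᵒᵖ, IsPerfect (tf.Φ.carrier A)}
  {NH : Subgroup (Field.absoluteGaloisGroup D.K) → tf.category → ℕ+ → Prop}
  {pullFrac : ∀ {A A' : (BiKummerSetting.mkOfThetaSettingYdd C e μ hC hS tf hZ hP NH).C} (_ : A' ⟶ A),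
    (BiKummerSetting.mkOfThetaSettingYdd C e μ hC hS tf hZ hP NH).biratUnits A →
      (BiKummerSetting.mkOfThetaSettingYdd C e μ hC hS tf hZ hP NH).biratUnits A'}
  {θ : (BiKummerSetting.mkOfThetaSettingYdd C e μ hC hS tf hZ hP NH).biratUnits (BiKummerSetting.mkOfThetaSettingYdd C e μ hC hS tf hZ hP NH).Aodot}
  {Bl : (BiKummerSetting.mkOfThetaSettingYdd C e μ hC hS tf hZ hP NH).C}
  {Pl : (BiKummerSetting.mkOfThetaSettingYdd C e μ hC hS tf hZ hP NH).FractionPair θ Bl}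
  {Rl : (BiKummerSetting.mkOfThetaSettingYdd C e μ hC hS tf hZ hP NH).NthRoot θ Pl C.lPNat pullFrac}
  (h : ModelFrobenioid.Hypotheses tf.divisorMonoid tf.ratFnFunctor)
  (Q : FrobenioidTheta.ThetaSubquotientStub.{0} (ConnectedPart (BTemp (C.temperedArithmeticGroup e).Pi)))
  (R : (BiKummerSetting.mkOfThetaSettingYdd C e μ hC hS tf hZ hP NH).NthRoot Rl.root Rl.pair N pullFrac)
  (K' : Type) [Field K'] (constEmb : K'ˣ →* tf.biratUnitsModel R.BN) (constEmb_injective : Function.Injective constEmb)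
  (hinvc : ∀ g : Aut R.AN.base,
    pull tf.divisorMonoid g.hom (ModelFrobenioid.div R.pair.num) = ModelFrobenioid.div R.pair.num)
  (hinvp : ∀ y : (C.thetaEnvData μ hC hS).PiX, y ∈ (C.thetaEnvData μ hC hS).PiYdd →
    pull tf.divisorMonoid ((BiKummerSetting.mkOfThetaSettingYdd C e μ hC hS tf hZ hP NH).galoisSurj
      R.AN.base R.αData.isGalois ((ContinuousMulEquiv.refl _) y)).hom (ModelFrobenioid.div R.pair.den) = ModelFrobenioid.div R.pair.den)

/-- **F-0558 with NO named `Π`-side input**, `η`-existential form, at the §5 data of the Setting with `A_⊙^bs := Ÿ̲̲` ("the object defined by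
the trivial line bundle over `Ÿ̲̲^log`", p.322; `hH` is abc-iut-L2-t4's THEOREM `hH_mkOfThetaSettingYdd`, `H_⊙ = Π^tp_Ÿ̲̲` on the nose).
[cite: MochizukiEtTh2009, Prop 5.2 (iii) p.324 (PDF p.98); §5 p.322 (PDF p.96); Prop 4.3 (iii) p.317 (PDF p.91)] -/
theorem exists_thetaPairKummerClass_ofThetaSettingYddData
    (ν : (ofThetaSettingData μ hC hS h Q R K' constEmb constEmb_injective hinvc hinvp).lDeltaModN
        (ofThetaSettingData μ hC hS h Q R K' constEmb constEmb_injective hinvc hinvp).BN ≃*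
      (ofThetaSettingData μ hC hS h Q R K' constEmb constEmb_injective hinvc hinvp).muTorsion
        (ofThetaSettingData μ hC hS h Q R K' constEmb constEmb_injective hinvc hinvp).BN
        (ofThetaSettingData μ hC hS h Q R K' constEmb constEmb_injective hinvc hinvp).N) :
    ∃ η : (ofThetaSettingData μ hC hS h Q R K' constEmb constEmb_injective hinvc hinvp).HB →
        (ofThetaSettingData μ hC hS h Q R K' constEmb constEmb_injective hinvc hinvp).lDeltaModN
          (ofThetaSettingData μ hC hS h Q R K' constEmb constEmb_injective hinvc hinvp).BN,
      FrobenioidThetaBiKummer.ThetaPairKummerClass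
        (ofThetaSettingData μ hC hS h Q R K' constEmb constEmb_injective hinvc hinvp) η ν :=
  exists_thetaPairKummerClass_ofThetaSettingData_of_hH μ hC hS h Q R K' constEmb constEmb_injective hinvc hinvp
    (BiKummerSetting.hH_mkOfThetaSettingYdd C e μ hC hS tf hZ hP NH) ν

/-- **Tranche-126 certificate at the §5 data of the Setting with `A_⊙^bs := Ÿ̲̲` — EMPTY named-hypothesis list beyond the construction
data**: F-0555 `StrvSection`, "`A_N` is Aut-ample" and F-0558 (`η`-existential, every `ν`) are THEOREMS of the data.  Inputs: `tf` (Ex. 3.9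
DATA), `h` ([FrdI] Thm. 5.2 hypotheses of the model), `Q`, the roots `Rl`/`R`, the constants `constEmb`, the divisor invariances `hinvc`
(p.330) / `hinvp` (Prop. 4.3 (i) proof, p.317); Setting side `e`, `hC`, `hS`, `μ` — no section hypothesis, no dictionary law, no `Facts` bundle,
no FACT-LIST name.  [cite: MochizukiEtTh2009, Prop 5.2 p.324 (PDF p.98); §5 p.322 (PDF p.96); §5 p.331 (PDF p.105)] -/
theorem prop52Rows_ofThetaSettingYddData :
    (ofThetaSettingData μ hC hS h Q R K' constEmb constEmb_injective hinvc hinvp).StrvSection ∧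
    (ofThetaSettingData μ hC hS h Q R K' constEmb constEmb_injective hinvc hinvp).IsAutAmple
        (ofThetaSettingData μ hC hS h Q R K' constEmb constEmb_injective hinvc hinvp).AN ∧
    ∀ ν : (ofThetaSettingData μ hC hS h Q R K' constEmb constEmb_injective hinvc hinvp).lDeltaModN
          (ofThetaSettingData μ hC hS h Q R K' constEmb constEmb_injective hinvc hinvp).BN ≃*
        (ofThetaSettingData μ hC hS h Q R K' constEmb constEmb_injective hinvc hinvp).muTorsion
          (ofThetaSettingData μ hC hS h Q R K' constEmb constEmb_injective hinvc hinvp).BN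
          (ofThetaSettingData μ hC hS h Q R K' constEmb constEmb_injective hinvc hinvp).N,
      ∃ η : (ofThetaSettingData μ hC hS h Q R K' constEmb constEmb_injective hinvc hinvp).HB →
          (ofThetaSettingData μ hC hS h Q R K' constEmb constEmb_injective hinvc hinvp).lDeltaModN
            (ofThetaSettingData μ hC hS h Q R K' constEmb constEmb_injective hinvc hinvp).BN,
        FrobenioidThetaBiKummer.ThetaPairKummerClass
          (ofThetaSettingData μ hC hS h Q R K' constEmb constEmb_injective hinvc hinvp) η ν :=
  prop52Rows_ofThetaSettingData_of_hH μ hC hS h Q R K' constEmb constEmb_injective hinvc hinvp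
    (BiKummerSetting.hH_mkOfThetaSettingYdd C e μ hC hS tf hZ hP NH)

/-- **Tranche-126 certificate at the binder-census object of record `ofThetaSettingDataQ` with `A_⊙^bs := Ÿ̲̲`** (abc-iut-L2-t4 MERGE-PLAN: the
§5 data of the Setting, `(l·Δ_Θ)_(−)` pinned to abc-iut-L2-t9's `ofSettingSub`, `H_⊙ = Π^tp_Ÿ̲̲`) — NO named `Π`-side input: F-0555 `StrvSection`,
"`A_N` is Aut-ample", F-0558 (`η`-existential, every `ν`).
[cite: MochizukiEtTh2009, Prop 5.2 p.324 (PDF p.98); §5 p.322 (PDF p.96); §5 p.327 (PDF p.101); §5 p.331 (PDF p.105)] -/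
theorem prop52Rows_ofThetaSettingYddDataQ :
    (ofThetaSettingDataQ μ hC hS h R K' constEmb constEmb_injective hinvc hinvp).StrvSection ∧
    (ofThetaSettingDataQ μ hC hS h R K' constEmb constEmb_injective hinvc hinvp).IsAutAmple
        (ofThetaSettingDataQ μ hC hS h R K' constEmb constEmb_injective hinvc hinvp).AN ∧
    ∀ ν : (ofThetaSettingDataQ μ hC hS h R K' constEmb constEmb_injective hinvc hinvp).lDeltaModN
          (ofThetaSettingDataQ μ hC hS h R K' constEmb constEmb_injective hinvc hinvp).BN ≃*
        (ofThetaSettingDataQ μ hC hS h R K' constEmb constEmb_injective hinvc hinvp).muTorsion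
          (ofThetaSettingDataQ μ hC hS h R K' constEmb constEmb_injective hinvc hinvp).BN
          (ofThetaSettingDataQ μ hC hS h R K' constEmb constEmb_injective hinvc hinvp).N,
      ∃ η : (ofThetaSettingDataQ μ hC hS h R K' constEmb constEmb_injective hinvc hinvp).HB →
          (ofThetaSettingDataQ μ hC hS h R K' constEmb constEmb_injective hinvc hinvp).lDeltaModN
            (ofThetaSettingDataQ μ hC hS h R K' constEmb constEmb_injective hinvc hinvp).BN,
        FrobenioidThetaBiKummer.ThetaPairKummerClass
          (ofThetaSettingDataQ μ hC hS h R K' constEmb constEmb_injective hinvc hinvp) η ν :=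
  prop52Rows_ofThetaSettingYddData μ hC hS h (ThetaSubquotient.ofSettingSub D l C.Huu) R K' constEmb constEmb_injective hinvc hinvp

end OfThetaSettingYddData

end ThetaFrobenioid

end Literature.AnabelianGeometry.EtaleTheta

end
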